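import Summits.ResolutionOfSingularities.ResolutionOfSingularities.Theorems.FrobeniusLadderFRationalResolutionMonomialMembershipTheta
import HarnessLib

/-!
# Crux `FrobeniusLadder.FRationalResolution` (stmt-ResolutionOfSingularities-15317), line `redirect`,
# stub `stub_diagonalizableQuotientResolution` — monomial ideal membership is COMBINATORIAL on d-form chart data
# (brick (θ) of the repair census, local-ring half)

The ideal-membership twin of `LogRegularCompleteStructure.chart_eq_of_isUnit_mul_of_dform0` / `…_of_dform`
(`LogRegularSharpening.lean`, Nizioł 2006 Lemma 2.4 (1)): for d-form chart data `φ : P → A` on a complete-able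
Noetherian local ring (`𝔪_A = (φ(P ∖ 0)) (+ (t))`, `dim A = rank P (+ d)`), **if `φ(w) ∈ (φ(w₁), …, φ(w_k)) A` then
`w ∈ wⱼ + P` for some `j`**. Proof as in the tree's unit version: pass to `Â ≅ Λ⟦P⟧/(θ)` (Kato (3.2),
`LogRegularCompleteStructure.exists_lift_surjective` / `exists_theta` / `ker_eq_span_theta` / `ker_eq_bot_of_field`) and
apply the power-series lemma `…MonomialMembershipTheta.monomial_sub_sum_mul_monomial_ne_theta_mul_of_supported`.
This is the input of Kato's regularity criterion ("log regular and regular ⇒ the sharp stalk monoid is free": a monomial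
minimal generator of Kato's ideal lying in the ideal of the others would be divisible by one of them in `P`).

* `exists_mem_add_of_mem_span_of_dform0` — `d = 0`;
* `exists_mem_add_of_mem_span_of_dform` — with parameters `t₁, …, t_d` (absorbed as extra monoid generators);
* **`LogChart.exists_sub_sub_mem_span_faceMonoid_of_mem_span`** — the `LogChart.IsLogRegularAt` form: log regular at `𝔭`,
  `φ(p) ∈ (φ(W)) A_𝔭` ⇒ `p − q − s ∈ ℤ F_𝔭` for some `q ∈ W`, `s ∈ P` (sharp embedding of `P/F_𝔭`,
  `exists_dformData_of_isLogRegularAt''`);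
* **`LogChart.forall_exists_sub_sum_nsmul_mem_span_faceMonoid`** — generation transfer: if finitely many NON-unit monomials
  `φ(Q)` generate Kato's ideal `I(𝔭) A_𝔭`, then every `p ∈ P` is an `ℕ`-combination of `Q` modulo `ℤ F_𝔭` (induction on
  the degree in a sharp embedding) — with `#Q = rank` this is the freeness half of Kato's regularity criterion.

Honest label: generic local algebra (no stub closed). No definitions, no named facts, no sorry.
[cite: Kato1994, (3.2), (6.1)] [cite: Niziol2006, Lemma 2.4]
-/

noncomputable section

-- single-problem summit: the doubled namespace component is forced
set_option linter.dupNamespace false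

open IsLocalRing MvPowerSeries Literature.RingTheory.MvPowerSeries
  Literature.RingTheory.MvPowerSeries.monoidPowerSeries
  Literature.RingTheory.CompleteLocalRings
open Literature.AlgebraicGeometry.Resolution Literature.AlgebraicGeometry.Resolution.LogRegularCompleteStructure
open Summit.ResolutionOfSingularities.ResolutionOfSingularities.Theorems.FRationalResolution.MonomialMembershipTheta

namespace Summit.ResolutionOfSingularities.ResolutionOfSingularities.Theorems.FRationalResolution.MonomialMembershipDform

universe u

variable {A : Type u} [CommRing A] [IsLocalRing A] [IsNoetherianRing A] {M d : ℕ}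
  {P : AddSubmonoid (Fin M →₀ ℕ)} {φ : (Fin M →₀ ℕ) → A}

/-- **`φ(w) ∈ (φ(W)) A` forces `w ∈ w' + P` for some `w' ∈ W`**, for d = 0 chart data (`𝔪_A = (φ(P ∖ 0))`,
`dim A = rank P`): in `Â ≅ Λ⟦P⟧/(θ)` the element `x^w − ∑ c̃ⱼ x^{wⱼ}` (`c̃ⱼ` lifts of the coefficients) would lie in
`(θ)`, contradicting `monomial_sub_sum_mul_monomial_ne_theta_mul_of_supported`. [cite: Kato1994, (3.2)]
[cite: Niziol2006, Lemma 2.4] -/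
theorem exists_mem_add_of_mem_span_of_dform0 (hP : P.FG) (hφ0 : φ 0 = 1)
    (hφadd : ∀ a ∈ P, ∀ b ∈ P, φ (a + b) = φ a * φ b)
    (hφm : ∀ p ∈ P, p ≠ 0 → φ p ∈ maximalIdeal A)
    (hgen : maximalIdeal A ≤ Ideal.span (φ '' {p | p ∈ P ∧ p ≠ 0}))
    (hdim : ringKrullDim A = rank P) {w : Fin M →₀ ℕ} (hw : w ∈ P) (W : Finset (Fin M →₀ ℕ))
    (hW : ∀ w' ∈ W, w' ∈ P) (h : φ w ∈ Ideal.span (φ '' (W : Set (Fin M →₀ ℕ)))) :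
    ∃ w' ∈ W, ∃ s ∈ P, w = w' + s := by
  classical
  by_contra hstd
  push Not at hstd
  haveI : IsNoetherianRing (AdicCompletion (maximalIdeal A) A) :=
    isNoetherianRing_adicCompletion_maximalIdeal A
  let φh : (Fin M →₀ ℕ) → AdicCompletion (maximalIdeal A) A := fun p => algebraMap A _ (φ p)
  have hφh0 : φh 0 = 1 := by simp only [φh, hφ0, map_one]
  have hφhadd : ∀ a ∈ P, ∀ b ∈ P, φh (a + b) = φh a * φh b := by
    intro a ha b hb; simp only [φh, hφadd a ha b hb, map_mul]
  have hφhm : ∀ p ∈ P, p ≠ 0 → φh p ∈ maximalIdeal (AdicCompletion (maximalIdeal A) A) := by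
    intro p hp hp0
    rw [AdicCompletion.maximalIdeal_eq_map]
    exact Ideal.mem_map_of_mem _ (hφm p hp hp0)
  have hgenh : maximalIdeal (AdicCompletion (maximalIdeal A) A) ≤
      Ideal.span (φh '' {p | p ∈ P ∧ p ≠ 0}) := by
    rw [AdicCompletion.maximalIdeal_eq_map]
    refine (Ideal.map_mono hgen).trans ?_
    rw [Ideal.map_span, ← Set.image_comp]
    rfl
  have hdimh : ringKrullDim (AdicCompletion (maximalIdeal A) A) = rank P := by
    rw [ringKrullDim_adicCompletion A, hdim]
  -- the relation in `Â`: `φ̂(w) = ∑ aⱼ φ̂(wⱼ)`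
  have hrel : ∃ a : (Fin M →₀ ℕ) → AdicCompletion (maximalIdeal A) A,
      φh w = ∑ w' ∈ W, a w' * φh w' := by
    have h' : φh w ∈ Ideal.span (φh '' (W : Set (Fin M →₀ ℕ))) := by
      have := Ideal.mem_map_of_mem (algebraMap A (AdicCompletion (maximalIdeal A) A)) h
      rw [Ideal.map_span, ← Set.image_comp] at this
      exact this
    rw [Set.image_eq_range] at h'
    obtain ⟨l, hl⟩ := Ideal.mem_span_range_iff_exists_fun.1 h'
    refine ⟨fun w' => if hw' : w' ∈ W then l ⟨w', hw'⟩ else 0, ?_⟩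
    have hsum : ∑ w' ∈ W, (if hw' : w' ∈ W then l ⟨w', hw'⟩ else 0) * φh w' =
        ∑ i : ↥W, l i * φh (i : Fin M →₀ ℕ) := by
      rw [← Finset.sum_coe_sort W]
      refine Finset.sum_congr rfl fun i _ => ?_
      rw [dif_pos i.2]
      rfl
    exact (hsum.trans hl).symm
  obtain ⟨a, ha⟩ := hrel
  -- the key step, for a surjection `ψ : R⟦P⟧ → Â` and lifts `c̃ⱼ` of the `aⱼ`
  have key : ∀ {R : Type u} [CommRing R] (ψ : monoidPowerSeries R P →+* AdicCompletion (maximalIdeal A) A),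
      (∀ (p : Fin M →₀ ℕ) (hp : p ∈ P),
        ψ ⟨MvPowerSeries.monomial p (1 : R), monomial_mem hp 1⟩ = φh p) →
      ∀ c : (Fin M →₀ ℕ) → monoidPowerSeries R P, (∀ w' ∈ W, ψ (c w') = a w') →
        (⟨MvPowerSeries.monomial w (1 : R), monomial_mem hw 1⟩ -
            ∑ w' ∈ W.attach, c w' * ⟨MvPowerSeries.monomial (w' : Fin M →₀ ℕ) (1 : R), monomial_mem (hW _ w'.2) 1⟩ :
            monoidPowerSeries R P) ∈ RingHom.ker ψ := by
    intro R _ ψ hψmon c hc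
    rw [RingHom.mem_ker, map_sub, map_sum, hψmon w hw, ha, ← Finset.sum_attach W, sub_eq_zero]
    refine Finset.sum_congr rfl fun x _ => ?_
    rw [map_mul, hc _ x.2, hψmon _ (hW _ x.2)]
  -- the value of that element of `R⟦P⟧` as a power series
  have hval : ∀ {R : Type u} [CommRing R] (c : (Fin M →₀ ℕ) → monoidPowerSeries R P),
      ((⟨MvPowerSeries.monomial w (1 : R), monomial_mem hw 1⟩ -
          ∑ w' ∈ W.attach, c w' * ⟨MvPowerSeries.monomial (w' : Fin M →₀ ℕ) (1 : R), monomial_mem (hW _ w'.2) 1⟩ :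
          monoidPowerSeries R P) : MvPowerSeries (Fin M) R) =
        MvPowerSeries.monomial w (1 : R) -
          ∑ w' ∈ W.attach, (c w' : MvPowerSeries (Fin M) R) * MvPowerSeries.monomial (w' : Fin M →₀ ℕ) 1 := by
    intro R _ c
    simp only [Subalgebra.coe_sub, AddSubmonoidClass.coe_finsetSum, Subalgebra.coe_mul]
  have hstd' : ∀ {R : Type u}, ∀ j ∈ W.attach, ∀ s ∈ P, w ≠ (fun x : ↥W => (x : Fin M →₀ ℕ)) j + s :=
    fun j _ s hs => hstd _ j.2 s hs
  obtain ⟨p, hp⟩ := CharP.exists (ResidueField (AdicCompletion (maximalIdeal A) A))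
  rcases CharP.char_is_prime_or_zero (ResidueField (AdicCompletion (maximalIdeal A) A)) p with
    hprime | rfl
  · haveI : Fact p.Prime := ⟨hprime⟩
    obtain ⟨R, _, _, _, hRN, hRc, hmax, hp0, j, hres⟩ :=
      exists_cohenDVR_ringHom (AdicCompletion (maximalIdeal A) A) p
    haveI := hRN
    haveI := hRc
    have hpA : (p : AdicCompletion (maximalIdeal A) A) ∈
        maximalIdeal (AdicCompletion (maximalIdeal A) A) := by
      rw [← residue_eq_zero_iff, map_natCast]; exact CharP.cast_eq_zero _ p
    haveI : IsLocalHom j := by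
      refine ⟨fun r hr => ?_⟩
      by_contra hrn
      have hrm : r ∈ maximalIdeal R := (mem_maximalIdeal _).2 (mem_nonunits_iff.2 hrn)
      rw [hmax, Ideal.mem_span_singleton] at hrm
      obtain ⟨s, rfl⟩ := hrm
      rw [map_mul, map_natCast] at hr
      exact ((mem_maximalIdeal _).1 (Ideal.mul_mem_right _ _ hpA)) hr
    obtain ⟨ψ, hψsurj, hψmon, hψC⟩ := exists_lift_surjective j hres hP φh hφh0 hφhadd hφhm hgenh
    have hjp : j (p : R) ∈ maximalIdeal _ := by rw [map_natCast]; exact hpA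
    obtain ⟨θ, hθ, hθπ⟩ := exists_theta ψ hψsurj j hψC φh hψmon hgenh (p : R) hjp
    have hker := ker_eq_span_theta hp0 hmax hP ψ hψsurj hdimh θ hθ hθπ
    -- lifts of the coefficients
    have hc : ∀ w' : Fin M →₀ ℕ, ∃ c : monoidPowerSeries R P, ψ c = a w' := fun w' => hψsurj (a w')
    choose c hc using hc
    have hX := key ψ hψmon c (fun w' _ => hc w')
    rw [hker, Ideal.mem_span_singleton'] at hX
    obtain ⟨g, hg⟩ := hX
    have hπm : (p : R) ∈ maximalIdeal R := hmax ▸ Ideal.subset_span rfl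
    have hval' := congrArg Subtype.val hg
    rw [Subalgebra.coe_mul] at hval'
    refine MonomialMembershipTheta.monomial_sub_sum_mul_monomial_ne_theta_mul_of_supported P (θ : MvPowerSeries (Fin M) R)
      (g : MvPowerSeries (Fin M) R) θ.2 ?_ ?_ W.attach (fun x => (c x : MvPowerSeries (Fin M) R))
      (fun x _ => (c x).2) (fun x : ↥W => (x : Fin M →₀ ℕ)) (hstd' (R := R)) ?_
    · rw [hθπ]; exact mem_nonZeroDivisors_of_ne_zero hp0
    · rw [hθπ]; exact (mem_maximalIdeal _).1 hπm
    · rw [← hval c, mul_comm (θ : MvPowerSeries (Fin M) R)]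
      exact hval'.symm
  · haveI : CharZero (ResidueField (AdicCompletion (maximalIdeal A) A)) := CharP.charP_to_charZero _
    obtain ⟨σ, hσ⟩ := exists_coefficientField_of_charZero (AdicCompletion (maximalIdeal A) A)
    have hbot : maximalIdeal (ResidueField (AdicCompletion (maximalIdeal A) A)) = ⊥ :=
      (IsLocalRing.isField_iff_maximalIdeal_eq).1 (Field.toIsField _)
    haveI : IsAdicComplete (maximalIdeal (ResidueField (AdicCompletion (maximalIdeal A) A)))
        (ResidueField (AdicCompletion (maximalIdeal A) A)) := by rw [hbot]; infer_instance
    haveI : IsLocalHom σ := by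
      refine ⟨fun x hx => ?_⟩
      by_contra hxn
      have hx0 : x = 0 := by by_contra h; exact hxn (Ne.isUnit h)
      rw [hx0, map_zero] at hx
      exact not_isUnit_zero hx
    have hres : ∀ b : AdicCompletion (maximalIdeal A) A, ∃ l, b - σ l ∈ maximalIdeal _ :=
      fun b => ⟨residue _ b, by rw [← residue_eq_zero_iff, map_sub, hσ, sub_self]⟩
    obtain ⟨ψ, hψsurj, hψmon, -⟩ := exists_lift_surjective σ hres hP φh hφh0 hφhadd hφhm hgenh
    have hker := ker_eq_bot_of_field hP ψ hψsurj hdimh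
    have hc : ∀ w' : Fin M →₀ ℕ, ∃ c : monoidPowerSeries _ P, ψ c = a w' := fun w' => hψsurj (a w')
    choose c hc using hc
    have hX := key ψ hψmon c (fun w' _ => hc w')
    rw [hker, Ideal.mem_bot] at hX
    have hX' := congrArg (fun x : monoidPowerSeries _ P => MvPowerSeries.coeff w
      (x : MvPowerSeries (Fin M) (ResidueField (AdicCompletion (maximalIdeal A) A)))) hX
    simp only [Subalgebra.coe_zero, map_zero] at hX'
    rw [hval c, map_sub, MvPowerSeries.coeff_monomial, if_pos rfl, map_sum, Finset.sum_eq_zero, sub_zero] at hX'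
    · exact one_ne_zero hX'
    · intro x _
      rw [MvPowerSeries.coeff_mul_monomial]
      split_ifs with hle
      · rw [(c x).2 (w - (x : Fin M →₀ ℕ)) (fun hs => hstd _ x.2 _ hs
          (by rw [add_tsub_cancel_of_le hle])), zero_mul]
      · rfl

/-- **`φ(w) ∈ (φ(W)) A` forces `w ∈ w' + P` for some `w' ∈ W`, d-form** (parameters `t₁..t_d`, `𝔪 = (φ(P ∖ 0)) + (t)`,
`rank P + d ≤ dim A`): absorb the parameters as extra monoid generators (`absorbMonoid`, `absorbChart`) and apply the
`d = 0` case. [cite: Kato1994, (3.2)] [cite: Niziol2006, Lemma 2.4] -/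
theorem exists_mem_add_of_mem_span_of_dform {t : Fin d → A} (hP : P.FG) (hφ0 : φ 0 = 1)
    (hφadd : ∀ a ∈ P, ∀ b ∈ P, φ (a + b) = φ a * φ b)
    (hφm : ∀ p ∈ P, p ≠ 0 → φ p ∈ maximalIdeal A) (ht : ∀ k, t k ∈ maximalIdeal A)
    (hgen : maximalIdeal A ≤ Ideal.span (φ '' {p | p ∈ P ∧ p ≠ 0}) ⊔ Ideal.span (Set.range t))
    (hdim : ((rank P + d : ℕ) : WithBot ℕ∞) ≤ ringKrullDim A) {w : Fin M →₀ ℕ} (hw : w ∈ P)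
    (W : Finset (Fin M →₀ ℕ)) (hW : ∀ w' ∈ W, w' ∈ P) (h : φ w ∈ Ideal.span (φ '' (W : Set (Fin M →₀ ℕ)))) :
    ∃ w' ∈ W, ∃ s ∈ P, w = w' + s := by
  classical
  have hdim' : ringKrullDim A = rank (absorbMonoid P d) := by
    rw [rank_absorbMonoid]
    exact le_antisymm (ringKrullDim_le_rank_add hP hφ0 hφadd hφm ht hgen) hdim
  have hW' : ∀ w' ∈ W.image (fun w' => absorbGlue M d (w', 0)), w' ∈ absorbMonoid P d := by
    intro w' hw'
    obtain ⟨w₀, hw₀, rfl⟩ := Finset.mem_image.1 hw'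
    exact absorbGlue_mem (hW _ hw₀) 0
  have hmem : absorbChart φ t (absorbGlue M d (w, 0)) ∈
      Ideal.span (absorbChart φ t '' (↑(W.image (fun w' => absorbGlue M d (w', 0))) : Set (Fin (M + d) →₀ ℕ))) := by
    rw [absorbChart_absorbGlue_zero]
    refine Ideal.span_mono ?_ h
    rintro _ ⟨w', hw', rfl⟩
    exact ⟨absorbGlue M d (w', 0), Finset.mem_coe.2 (Finset.mem_image.2 ⟨w', hw', rfl⟩),
      absorbChart_absorbGlue_zero φ t w'⟩
  obtain ⟨ww, hww, s, hs, hEq⟩ := exists_mem_add_of_mem_span_of_dform0 (absorbMonoid_fg hP)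
    (absorbChart_zero hφ0 t) (absorbChart_add hφadd t) (absorbChart_mem_maximalIdeal hφm ht)
    (maximalIdeal_le_span_absorbChart hφ0 hgen) hdim' (absorbGlue_mem hw 0) _ hW' hmem
  obtain ⟨w', hw'W, rfl⟩ := Finset.mem_image.1 hww
  refine ⟨w', hw'W, absorbProj₁ M d s, mem_absorbMonoid.1 hs, ?_⟩
  have h2 := congrArg (absorbProj₁ M d) hEq
  rwa [map_add, absorbProj₁_absorbGlue, absorbProj₁_absorbGlue] at h2

end Summit.ResolutionOfSingularities.ResolutionOfSingularities.Theorems.FRationalResolution.MonomialMembershipDform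

namespace Literature.AlgebraicGeometry.Resolution.LogChart

open Summit.ResolutionOfSingularities.ResolutionOfSingularities.Theorems.FRationalResolution.MonomialMembershipDform

universe v

variable {A : Type v} [CommRing A] [IsNoetherianRing A] {n : ℕ} {P : AddSubmonoid (Fin n → ℤ)}
  {φ : Multiplicative P →* A} {𝔭 : Ideal A} [𝔭.IsPrime]

/-- **Monomial ideal membership is combinatorial in a log regular local ring** (Kato 1994 (6.1)-type statement): for a
chart `φ : P → A` by a finitely generated saturated `P ⊆ ℤⁿ`, log regular at the prime `𝔭`, and `p ∈ P`, `W ⊆ P`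
finite: **if `φ(p) ∈ (φ(q) : q ∈ W) · A_𝔭` then `p − q − s ∈ ℤ F_𝔭` for some `q ∈ W`, `s ∈ P`** — i.e. `p ∈ q + P`
modulo the unit face `F_𝔭 = {q : φ(q) ∉ 𝔭}`. (Sharp embedding of `P/F_𝔭` + d-form chart data,
`exists_dformData_of_isLogRegularAt''`, then `exists_mem_add_of_mem_span_of_dform`.) [cite: Kato1994, (3.2), (6.1)]
[cite: Niziol2006, Lemma 2.4] -/
theorem exists_sub_sub_mem_span_faceMonoid_of_mem_span (hP : P.FG)
    (hsat : ∀ (v : Fin n → ℤ) (k : ℕ), 0 < k → k • v ∈ P → v ∈ P) (hreg : IsLogRegularAt P φ 𝔭)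
    (p : P) (W : Finset P)
    (h : algebraMap A (Localization.AtPrime 𝔭) (φ (Multiplicative.ofAdd p)) ∈
      Ideal.span ((fun q : P => algebraMap A (Localization.AtPrime 𝔭) (φ (Multiplicative.ofAdd q))) '' (W : Set P))) :
    ∃ q ∈ W, ∃ s : P, (p : Fin n → ℤ) - q - s ∈ Submodule.span ℤ (faceMonoid P φ 𝔭 : Set (Fin n → ℤ)) := by
  classical
  haveI : IsNoetherianRing (Localization.AtPrime 𝔭) :=
    IsLocalization.isNoetherianRing 𝔭.primeCompl (Localization.AtPrime 𝔭) inferInstance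
  obtain ⟨e, he, π, d, t, hD, hcompat⟩ := exists_dformData_of_isLogRegularAt'' hP hsat hreg
  -- the generators in the embedded chart differ from the `φ(q)` by units
  have hspan : Ideal.span ((fun q : P => algebraMap A (Localization.AtPrime 𝔭) (φ (Multiplicative.ofAdd q))) ''
      (W : Set P)) ≤ Ideal.span (embChart he π '' (↑(W.image (embHom he)) : Set (Fin n →₀ ℕ))) := by
    refine Ideal.span_le.2 ?_
    rintro _ ⟨q, hq, rfl⟩
    obtain ⟨v, hv⟩ := hcompat q
    rw [val_of_mem P φ q.2, Subtype.coe_eta] at hv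
    show algebraMap A (Localization.AtPrime 𝔭) (φ (Multiplicative.ofAdd q)) ∈ _
    rw [← hv]
    exact Ideal.mul_mem_right _ _ (Ideal.subset_span
      ⟨embHom he q, Finset.mem_coe.2 (Finset.mem_image.2 ⟨q, hq, rfl⟩), rfl⟩)
  have hmem : embChart he π (embHom he p) ∈
      Ideal.span (embChart he π '' (↑(W.image (embHom he)) : Set (Fin n →₀ ℕ))) := by
    obtain ⟨v, hv⟩ := hcompat p
    rw [val_of_mem P φ p.2, Subtype.coe_eta] at hv
    have : embChart he π (embHom he p) = algebraMap A (Localization.AtPrime 𝔭) (φ (Multiplicative.ofAdd p)) * ↑v⁻¹ := by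
      rw [← hv, mul_assoc, Units.mul_inv, mul_one]
    rw [this]
    exact Ideal.mul_mem_right _ _ (hspan h)
  have hW' : ∀ w' ∈ W.image (embHom he), w' ∈ embMonoid he := by
    intro w' hw'
    obtain ⟨q, -, rfl⟩ := Finset.mem_image.1 hw'
    exact (mem_embMonoid he).2 ⟨q, rfl⟩
  obtain ⟨w', hw', s, hs, hEq⟩ := exists_mem_add_of_mem_span_of_dform hD.fg hD.map_zero hD.map_add
    hD.mem_maximalIdeal hD.param_mem hD.gen hD.rank_le ((mem_embMonoid he).2 ⟨p, rfl⟩) _ hW' hmem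
  obtain ⟨q, hq, rfl⟩ := Finset.mem_image.1 hw'
  obtain ⟨r, rfl⟩ := (mem_embMonoid he).1 hs
  refine ⟨q, hq, r, ?_⟩
  have h1 : embHom he p = embHom he (q + r) := by rw [map_add]; exact hEq
  have h2 := he.inj _ p.2 _ (q + r).2 ((embHom_eq_iff he).1 h1)
  rwa [AddSubmonoid.coe_add, ← sub_sub] at h2

/-- **Generation transfer: monomial generators of Kato's ideal generate the monoid modulo the unit face.** For a chart
`φ : P → A` (finitely generated saturated `P ⊆ ℤⁿ`, `A` Noetherian) log regular at `𝔭` and a finite `Q ⊆ P` of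
NON-unit elements (`φ(q) ∈ 𝔭`) whose images generate Kato's ideal `I(𝔭) A_𝔭`: every `p ∈ P` is an `ℕ`-combination of
`Q` modulo `ℤ F_𝔭`. (Induction on the degree of `p` in a sharp embedding of `P/F_𝔭`: a non-unit `p` has `φ(p) ∈ I(𝔭)`, so
`p ∈ q + s + ℤF_𝔭` by `exists_sub_sub_mem_span_faceMonoid_of_mem_span`, with `s` of smaller degree.) With `#Q = rank`, this
is the freeness of `P/F_𝔭` in Kato's regularity criterion. [cite: Kato1994, (3.2), (6.1)] -/
theorem forall_exists_sub_sum_nsmul_mem_span_faceMonoid (hP : P.FG)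
    (hsat : ∀ (v : Fin n → ℤ) (k : ℕ), 0 < k → k • v ∈ P → v ∈ P) (hreg : IsLogRegularAt P φ 𝔭)
    (Q : Finset P) (hQ𝔭 : ∀ q ∈ Q, φ (Multiplicative.ofAdd q) ∈ 𝔭)
    (hQ : (ideal P φ 𝔭).map (algebraMap A (Localization.AtPrime 𝔭)) ≤
      Ideal.span ((fun q : P => algebraMap A (Localization.AtPrime 𝔭) (φ (Multiplicative.ofAdd q))) '' (Q : Set P))) :
    ∀ p : P, ∃ c : P → ℕ,
      (p : Fin n → ℤ) - ∑ q ∈ Q, c q • (q : Fin n → ℤ) ∈ Submodule.span ℤ (faceMonoid P φ 𝔭 : Set (Fin n → ℤ)) := by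
  classical
  obtain ⟨e, he⟩ := exists_isSharpEmbedding hP (isFaceOf_faceMonoid P φ 𝔭) hsat
  -- degree in the sharp embedding; non-units have positive degree
  have hdeg0 : ∀ q : P, φ (Multiplicative.ofAdd q) ∈ 𝔭 → (embHom he q).degree ≠ 0 := by
    intro q hq hdeg
    have h0 : embHom he q = 0 := (Finsupp.degree_eq_zero_iff _).1 hdeg
    have h1 : e (q : Fin n → ℤ) = e ((0 : P) : Fin n → ℤ) := by
      rw [← embHom_eq_iff he, h0, map_zero]
    have h2 := he.inj _ q.2 _ (0 : P).2 h1
    rw [ZeroMemClass.coe_zero, sub_zero] at h2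
    have h3 := (isFaceOf_faceMonoid P φ 𝔭).mem_of_mem_span_of_mem h2 q.2
    have h4 : val P φ (q : Fin n → ℤ) ∉ 𝔭 := h3.2
    rw [val_of_mem P φ q.2, Subtype.coe_eta] at h4
    exact h4 hq
  -- strong induction on the degree
  suffices hmain : ∀ N : ℕ, ∀ p : P, (embHom he p).degree ≤ N → ∃ c : P → ℕ,
      (p : Fin n → ℤ) - ∑ q ∈ Q, c q • (q : Fin n → ℤ) ∈ Submodule.span ℤ (faceMonoid P φ 𝔭 : Set (Fin n → ℤ)) from
    fun p => hmain _ p le_rfl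
  intro N
  induction N with
  | zero =>
    intro p hp
    refine ⟨0, ?_⟩
    simp only [Pi.zero_apply, zero_smul, Finset.sum_const_zero, sub_zero]
    -- degree 0: `p ∈ F`
    by_cases hp𝔭 : φ (Multiplicative.ofAdd p) ∈ 𝔭
    · exact absurd (Nat.le_zero.1 hp) (hdeg0 p hp𝔭)
    · refine Submodule.subset_span ⟨p.2, ?_⟩
      rw [val_of_mem P φ p.2, Subtype.coe_eta]; exact hp𝔭
  | succ N ih =>
    intro p hp
    by_cases hp𝔭 : φ (Multiplicative.ofAdd p) ∈ 𝔭
    · -- `φ(p) ∈ I(𝔭) A_𝔭 ⊆ (φ(Q))`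
      have hmem : algebraMap A (Localization.AtPrime 𝔭) (φ (Multiplicative.ofAdd p)) ∈
          Ideal.span ((fun q : P => algebraMap A (Localization.AtPrime 𝔭) (φ (Multiplicative.ofAdd q))) ''
            (Q : Set P)) :=
        hQ (Ideal.mem_map_of_mem _ (Ideal.subset_span ⟨p, hp𝔭, rfl⟩))
      obtain ⟨q, hq, s, hs⟩ := exists_sub_sub_mem_span_faceMonoid_of_mem_span hP hsat hreg p Q hmem
      -- degree bookkeeping: `e p = e q + e s`, `deg q > 0`
      have hes : embHom he p = embHom he q + embHom he s := by
        have h1 : e ((p : Fin n → ℤ) - q - s) = 0 := he.map_span hs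
        rw [map_sub, map_sub, sub_sub, sub_eq_zero, ← map_add] at h1
        rw [← map_add, embHom_eq_iff he]
        simpa using h1
      have hsdeg : (embHom he s).degree ≤ N := by
        have h1 : (embHom he p).degree = (embHom he q).degree + (embHom he s).degree := by
          rw [hes, map_add]
        have h2 := hdeg0 q (hQ𝔭 q hq)
        omega
      obtain ⟨c, hc⟩ := ih s hsdeg
      let c' : P → ℕ := fun x => c x + if x = q then 1 else 0
      refine ⟨c', ?_⟩
      have hsum : ∑ x ∈ Q, c' x • (x : Fin n → ℤ) =
          ∑ x ∈ Q, c x • (x : Fin n → ℤ) + (q : Fin n → ℤ) := by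
        simp only [c', add_smul, Finset.sum_add_distrib, ite_smul, one_smul, zero_smul,
          Finset.sum_ite_eq', if_pos hq]
      rw [hsum]
      have : (p : Fin n → ℤ) - (∑ x ∈ Q, c x • (x : Fin n → ℤ) + (q : Fin n → ℤ)) =
          ((p : Fin n → ℤ) - q - s) + ((s : Fin n → ℤ) - ∑ x ∈ Q, c x • (x : Fin n → ℤ)) := by abel
      rw [this]
      exact Submodule.add_mem _ hs hc
    · refine ⟨0, ?_⟩
      simp only [Pi.zero_apply, zero_smul, Finset.sum_const_zero, sub_zero]
      refine Submodule.subset_span ⟨p.2, ?_⟩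
      rw [val_of_mem P φ p.2, Subtype.coe_eta]; exact hp𝔭

end Literature.AlgebraicGeometry.Resolution.LogChart

end
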